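import Mathlib
import Literature.Analysis.FluidPDE.Tao2016AveragedNS.RenormalisedCascadeWaves
import Literature.Analysis.FluidPDE.Tao2016AveragedNS.SelfSimilarCascadeBlowup
import Literature.Analysis.FluidPDE.Tao2016AveragedNS.ViscousEternalSolutions
import Literature.Analysis.FluidPDE.Tao2016AveragedNS.BoundedEternalSolutions
import Summits.NavierStokesRegularity.NavierStokesRegularity.Theses.TaoLadderRungTwoBreak
import Summits.NavierStokesRegularity.NavierStokesRegularity.Theorems.WakeRatchetAdmissibleEternalBoundCritical
import Summits.NavierStokesRegularity.NavierStokesRegularity.Theorems.WakeRatchetAdmissibleEternalBoundCriticalVisc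
import Summits.NavierStokesRegularity.NavierStokesRegularity.Theorems.WakeRatchetAdmissibleEternalBoundTerminal

/-!
# Crux `TaoLadderRungTwoBreak.NoSurvivingEternalViscBddOne` (stmt-NavierStokesRegularity-20419):
# THE CRUX IN CLASSICAL FORM — a Liouville statement for type-I ancient solutions of Tao's AUTONOMOUS cascade
# lattice with constant per-shell viscosity (exact equivalence, by name)

MODEL lattice ODEs only (Tao 2016 §4, §6.4); nothing in this file is a statement about the Navier–Stokes
equations, and no stub, crux, rung or summit is proved by it.

In the critical variables `V_n(t) = (-t)⁻¹ W_n(-log(-t)) = Λ^n X_n(t)` (blow-up time `0`) an admissible eternal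
solution with covariant viscosity `ν̂ ≥ 0` (`IsEternalVisc ε₀ ν̂ α W`) is a solution of the AUTONOMOUS lattice

  `V̇_n = Q(V_n) + Λ A(V_{n-1}) + Λ⁻¹ B(V_{n+1}, V_n) − ν̂ (1+ε₀)^{2n} V_n`   on `t < 0`      (crit)

(tree `hasDerivAt_crit_visc`; inviscid `hasDerivAt_crit`), `UniformBound W` is the TYPE-I bound `‖V_n(t)‖ ≤ C/(-t)`,
the action clause is `∫_{t<0}‖V_n‖ ≤ M` (tree `integral_crit_eq`), the forward clause is boundedness of `V_n` near
`0⁻` (tree `exists_norm_crit_le`), and forward (S_a)-survival reads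

  `∃ c > 0 ∀ N ∃ n ≥ N ∃ t ∈ [-e^{-N}, 0):  physWeight(a)^n ‖V_n(t)‖² ≥ c`      (surv)

(`physWeight(1) = (1+ε₀)^{-4}`; physically `(1+ε₀)^n E_n(t) ≥ c` arbitrarily high and late).  Conversely every solution
of (crit) with these properties embeds as such a `W` (`isEternalVisc_of_classical`, `W_n(σ) = e^{-σ} • V_n(0 − e^{-σ})`,
the tree's re-centring at centre `0`).  Hence the EXACT restatements

* `noSurvivingEternalViscBdd_iff_classical` — `NoSurvivingEternalViscBdd R a` ⟺ «∃ εs > 0 ∀ ε₀ ∈ (0,εs] ∀ α ∈ E₂(R)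
  ∀ ν̂ ≥ 0: no solution of (crit) on `t < 0` with the type-I bound, uniformly integrable shells and shells bounded near
  `0⁻` satisfies (surv)»;
* `noSurvivingEternalViscBddOne_iff_classical` — the crux K1ᵛ(1) BY NAME ⟺ that statement for every `R ≥ 1` at
  `a = 1`; in particular `noSurvivingEternalViscBddOne_of_classical` is a by-name SUFFICIENT CONDITION for the crux
  stated without any of the cell's renormalised vocabulary.

HONEST LABEL: dictionary work over the tree's critical-variable machinery (`WakeRatchetCritical`, `…CriticalVisc`,
`WakeRatchetTerminal`); the classical statement is the same open Liouville problem; crux ⟨20419⟩ and every NS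
statement remain OPEN.
-/

noncomputable section

-- the summit and its single sub-problem share the name (CONVENTIONS §1)
set_option linter.dupNamespace false

namespace Summit.NavierStokesRegularity.NavierStokesRegularity.Theorems.NoSurvivingEternalViscBddOne.ClassicalForm

open Filter Topology Set MeasureTheory
open Literature.Analysis.FluidPDE Literature.Analysis.FluidPDE.TaoCascade
open Summit.NavierStokesRegularity.NavierStokesRegularity.Theses.TaoLadderRungTwoBreak
open Summit.NavierStokesRegularity.NavierStokesRegularity.Theorems.WakeRatchetCritical
  (integrable_recentre_iff hasDerivAt_sub_exp_neg integral_crit_eq tableQ_smul tableA_smul tableB_smul_smul)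
open Summit.NavierStokesRegularity.NavierStokesRegularity.Theorems.WakeRatchetTerminal
  (hasDerivAt_crit_visc exists_norm_crit_le)

variable {m : ℕ} {ε₀ νh a : ℝ} {α : Fin m → Fin m → Fin m → ℤ × ℤ × ℤ → ℝ}

/-! ## From a classical solution to an admissible eternal solution (centre `0`) -/

/-- **EMBEDDING at centre `0`.**  A solution `V` of the autonomous viscous lattice (crit) on `t < 0` (`ν̂ ≥ 0`) with
uniformly integrable shells and shells bounded near `0⁻` gives the admissible eternal solution
`W_n(σ) := e^{-σ} • V_n(0 − e^{-σ})` with covariant viscosity `ν̂` (the tree's `isEternalVisc_recentre`, centre `0`).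
[cite: Tao2016AveragedNS, §4, the viscous equation before Thm. 4.2, Lemma 4.1 (4.8), §6.4; cell vocabulary (`IsEternalVisc`)] -/
theorem isEternalVisc_of_classical (hν : 0 ≤ νh) {V : ℤ → ℝ → Em m}
    (hV : ∀ (n : ℤ) (t : ℝ), t < 0 → HasDerivAt (V n)
      (tableQ α (V n t) + bigLam ε₀ • tableA α (V (n - 1) t)
        + (bigLam ε₀)⁻¹ • tableB α (V (n + 1) t) (V n t)
        - (νh * (1 + ε₀) ^ ((2 : ℝ) * n)) • V n t) t)
    (hact : ∃ M : ℝ, ∀ n : ℤ, IntegrableOn (fun t => ‖V n t‖) (Iio 0) ∧ ∫ t in Iio 0, ‖V n t‖ ≤ M)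
    (hbd : ∀ n : ℤ, ∃ t₀ : ℝ, t₀ < 0 ∧ ∃ P : ℝ, ∀ t : ℝ, t₀ ≤ t → t < 0 → ‖V n t‖ ≤ P) :
    IsEternalVisc ε₀ νh α (fun n σ => Real.exp (-σ) • V n (0 - Real.exp (-σ))) := by
  obtain ⟨M, hM⟩ := hact
  refine ⟨fun n σ => ?_, hν, ⟨M, fun n => ?_⟩, fun n => ?_⟩
  · have hlt : 0 - Real.exp (-σ) < 0 := by have := Real.exp_pos (-σ); linarith
    have hexp : HasDerivAt (fun s : ℝ => Real.exp (-s)) (-Real.exp (-σ)) σ := by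
      have h1 : HasDerivAt (fun s : ℝ => Real.exp (-s)) (Real.exp (-σ) * (-1)) σ :=
        (Real.hasDerivAt_exp (-σ)).comp σ ((hasDerivAt_id σ).neg)
      convert h1 using 1; ring
    have hcomp := (hV n _ hlt).scomp σ (hasDerivAt_sub_exp_neg 0 σ)
    have hder := hexp.smul hcomp
    refine hder.congr_deriv ?_
    simp only [Function.comp_apply, tableQ_smul, tableA_smul, tableB_smul_smul, smul_add, smul_sub,
      smul_smul, neg_smul]
    module
  · have h := integrable_recentre_iff (V n) 0
    exact ⟨h.1.2 (hM n).1, by rw [h.2 (hM n).1]; exact (hM n).2⟩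
  · obtain ⟨t₀, ht₀, P, hP⟩ := hbd n
    refine ⟨-Real.log (-t₀), P ^ 2, fun σ hσ => ?_⟩
    have hnt₀ : 0 < -t₀ := neg_pos.2 ht₀
    have hle : t₀ ≤ 0 - Real.exp (-σ) := by
      have h1 : Real.exp (-σ) ≤ Real.exp (Real.log (-t₀)) := Real.exp_le_exp.2 (by linarith)
      rw [Real.exp_log hnt₀] at h1
      linarith
    have ht2 : 0 - Real.exp (-σ) < 0 := by have := Real.exp_pos (-σ); linarith
    have hPt := hP _ hle ht2
    have hw : Real.exp (2 * σ) * ‖Real.exp (-σ) • V n (0 - Real.exp (-σ))‖ ^ 2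
        = ‖V n (0 - Real.exp (-σ))‖ ^ 2 := by
      rw [norm_smul, Real.norm_eq_abs, abs_of_pos (Real.exp_pos _), mul_pow, ← mul_assoc,
        ← Real.exp_nat_mul, ← Real.exp_add]
      have : (2 : ℝ) * σ + ((2 : ℕ) : ℝ) * -σ = 0 := by push_cast; ring
      rw [this, Real.exp_zero, one_mul]
    rw [hw]
    exact pow_le_pow_left₀ (norm_nonneg _) hPt 2

/-- Type I ⇒ the embedded solution is uniformly bounded: `‖W_n(σ)‖ = e^{-σ}‖V_n(-e^{-σ})‖ ≤ C`.
[cite: Tao2016AveragedNS, §6.4; cell vocabulary (`UniformBound`)] -/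
theorem uniformBound_of_classical {V : ℤ → ℝ → Em m} {C : ℝ}
    (hC : ∀ (n : ℤ) (t : ℝ), t < 0 → ‖V n t‖ ≤ C / (-t)) :
    UniformBound (fun n σ => Real.exp (-σ) • V n (0 - Real.exp (-σ))) := by
  refine ⟨C, fun n σ => ?_⟩
  have hpos : 0 < Real.exp (-σ) := Real.exp_pos _
  have hlt : 0 - Real.exp (-σ) < 0 := by linarith
  have h := hC n (0 - Real.exp (-σ)) hlt
  rw [show -(0 - Real.exp (-σ)) = Real.exp (-σ) by ring, le_div_iff₀ hpos] at h
  show ‖Real.exp (-σ) • V n (0 - Real.exp (-σ))‖ ≤ C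
  rw [norm_smul, Real.norm_eq_abs, abs_of_pos hpos]
  linarith

/-- Survival of the embedded solution is (surv) for `V`.
[cite: Tao2016AveragedNS, §4 Thm. 4.2 (statement shape), §6.4; cell vocabulary (`EternalSurvivingFwd`)] -/
theorem survivingFwd_embed_imp {V : ℤ → ℝ → Em m}
    (hS : EternalSurvivingFwd a ε₀ (fun n σ => Real.exp (-σ) • V n (0 - Real.exp (-σ)))) :
    ∃ c : ℝ, 0 < c ∧ ∀ N : ℕ, ∃ n : ℕ, N ≤ n ∧ ∃ t : ℝ, -Real.exp (-(N : ℝ)) ≤ t ∧ t < 0 ∧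
      c ≤ physWeight a ε₀ ^ n * ‖V n t‖ ^ 2 := by
  obtain ⟨c, hc, H⟩ := hS
  refine ⟨c, hc, fun N => ?_⟩
  obtain ⟨n, hn, σ, hσ, hle⟩ := H N
  refine ⟨n, hn, 0 - Real.exp (-σ), ?_, by have := Real.exp_pos (-σ); linarith, ?_⟩
  · have : Real.exp (-σ) ≤ Real.exp (-(N : ℝ)) := Real.exp_le_exp.2 (by linarith)
    linarith
  · have hw : Real.exp (2 * σ) * ‖Real.exp (-σ) • V n (0 - Real.exp (-σ))‖ ^ 2
        = ‖V n (0 - Real.exp (-σ))‖ ^ 2 := by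
      rw [norm_smul, Real.norm_eq_abs, abs_of_pos (Real.exp_pos _), mul_pow, ← mul_assoc,
        ← Real.exp_nat_mul, ← Real.exp_add]
      have : (2 : ℝ) * σ + ((2 : ℕ) : ℝ) * -σ = 0 := by push_cast; ring
      rw [this, Real.exp_zero, one_mul]
    have : physWeight a ε₀ ^ n * (Real.exp (2 * σ) * ‖Real.exp (-σ) • V (n : ℤ) (0 - Real.exp (-σ))‖ ^ 2)
        = physWeight a ε₀ ^ n * ‖V n (0 - Real.exp (-σ))‖ ^ 2 := by rw [hw]
    rw [← this]
    exact hle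

/-! ## From an admissible eternal solution to a classical solution -/

/-- (surv) for the critical variable `V_n(t) = (-t)⁻¹ • W_n(-log(-t))` implies forward survival of `W`.
[cite: Tao2016AveragedNS, §4 Thm. 4.2 (statement shape), §6.4; cell vocabulary (`EternalSurvivingFwd`)] -/
theorem survivingFwd_of_crit {W : ℤ → ℝ → Em m}
    (h : ∃ c : ℝ, 0 < c ∧ ∀ N : ℕ, ∃ n : ℕ, N ≤ n ∧ ∃ t : ℝ, -Real.exp (-(N : ℝ)) ≤ t ∧ t < 0 ∧
      c ≤ physWeight a ε₀ ^ n * ‖(-t)⁻¹ • W n (-Real.log (-t))‖ ^ 2) :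
    EternalSurvivingFwd a ε₀ W := by
  obtain ⟨c, hc, H⟩ := h
  refine ⟨c, hc, fun N => ?_⟩
  obtain ⟨n, hn, t, htN, ht, hle⟩ := H N
  have hnt : 0 < -t := neg_pos.2 ht
  refine ⟨n, hn, -Real.log (-t), ?_, ?_⟩
  · -- `-log(-t) ≥ N` since `-t ≤ e^{-N}`
    have h1 : Real.log (-t) ≤ Real.log (Real.exp (-(N : ℝ))) := Real.log_le_log hnt (by linarith)
    rw [Real.log_exp] at h1
    linarith
  · have he : Real.exp (2 * -Real.log (-t)) = ((-t)⁻¹) ^ 2 := by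
      rw [show (2 : ℝ) * -Real.log (-t) = ((2 : ℕ) : ℝ) * (-Real.log (-t)) by push_cast; ring,
        Real.exp_nat_mul, Real.exp_neg, Real.exp_log hnt]
    have hw : Real.exp (2 * -Real.log (-t)) * ‖W (n : ℤ) (-Real.log (-t))‖ ^ 2
        = ‖(-t)⁻¹ • W n (-Real.log (-t))‖ ^ 2 := by
      rw [he, norm_smul, Real.norm_eq_abs, abs_of_pos (inv_pos.2 hnt), mul_pow]
    rw [hw]
    exact hle

variable {W : ℤ → ℝ → Em m}

/-- The critical variable of a uniformly bounded solution is TYPE I: `‖V_n(t)‖ ≤ C/(-t)`.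
[cite: Tao2016AveragedNS, §6.4; cell vocabulary (`UniformBound`)] -/
theorem crit_typeI (hU : UniformBound W) :
    ∃ C : ℝ, ∀ (n : ℤ) (t : ℝ), t < 0 → ‖(-t)⁻¹ • W n (-Real.log (-t))‖ ≤ C / (-t) := by
  obtain ⟨C, hC⟩ := hU
  refine ⟨C, fun n t ht => ?_⟩
  have hnt : 0 < -t := neg_pos.2 ht
  rw [norm_smul, Real.norm_eq_abs, abs_of_pos (inv_pos.2 hnt), div_eq_inv_mul]
  exact mul_le_mul_of_nonneg_left (hC n _) (inv_pos.2 hnt).le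

/-- The critical variable of an admissible solution has uniformly integrable shells on `(-∞,0)`.
[cite: Tao2016AveragedNS, §6.4; tree `integral_crit_eq`] -/
theorem crit_action (hW : IsEternalVisc ε₀ νh α W) :
    ∃ M : ℝ, ∀ n : ℤ, IntegrableOn (fun t : ℝ => ‖(-t)⁻¹ • W n (-Real.log (-t))‖) (Iio 0) ∧
      ∫ t in Iio 0, ‖(-t)⁻¹ • W n (-Real.log (-t))‖ ≤ M := by
  obtain ⟨M, hM⟩ := hW.action
  refine ⟨M, fun n => ?_⟩
  have h := integral_crit_eq (W n)
  exact ⟨h.1.1 (hM n).1, by rw [h.2 (hM n).1]; exact (hM n).2⟩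

/-! ## The equivalences -/

/-- **`NoSurvivingEternalViscBdd R a` IN CLASSICAL FORM (exact).**  The bounded viscous Liouville predicate at
spread `R`, exponent `a` ⟺ below a threshold, for every E₂(R) table and every `ν̂ ≥ 0`, no solution of the
autonomous lattice (crit) on `t < 0` with the type-I bound, uniformly integrable shells and shells bounded near `0⁻`
satisfies (surv).
[cite: Tao2016AveragedNS, §4 Thm. 4.2 (statement shape) and the viscous equation before it, §6.4; this file] -/
theorem noSurvivingEternalViscBdd_iff_classical (R a : ℝ) :
    NoSurvivingEternalViscBdd R a ↔
    ∃ εs : ℝ, 0 < εs ∧ ∀ ε₀ : ℝ, 0 < ε₀ → ε₀ ≤ εs →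
      ∀ α : Fin 4 → Fin 4 → Fin 4 → ℤ × ℤ × ℤ → ℝ, InTableClass R α →
        ∀ νh : ℝ, 0 ≤ νh → ∀ V : ℤ → ℝ → Em 4,
          (∀ (n : ℤ) (t : ℝ), t < 0 → HasDerivAt (V n)
            (tableQ α (V n t) + bigLam ε₀ • tableA α (V (n - 1) t)
              + (bigLam ε₀)⁻¹ • tableB α (V (n + 1) t) (V n t)
              - (νh * (1 + ε₀) ^ ((2 : ℝ) * n)) • V n t) t) →
          (∃ C : ℝ, ∀ (n : ℤ) (t : ℝ), t < 0 → ‖V n t‖ ≤ C / (-t)) →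
          (∃ M : ℝ, ∀ n : ℤ, IntegrableOn (fun t => ‖V n t‖) (Iio 0) ∧ ∫ t in Iio 0, ‖V n t‖ ≤ M) →
          (∀ n : ℤ, ∃ t₀ : ℝ, t₀ < 0 ∧ ∃ P : ℝ, ∀ t : ℝ, t₀ ≤ t → t < 0 → ‖V n t‖ ≤ P) →
            ¬ ∃ c : ℝ, 0 < c ∧ ∀ N : ℕ, ∃ n : ℕ, N ≤ n ∧ ∃ t : ℝ, -Real.exp (-(N : ℝ)) ≤ t ∧ t < 0 ∧
                c ≤ physWeight a ε₀ ^ n * ‖V n t‖ ^ 2 := by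
  constructor
  · rintro ⟨εs, hεs, H⟩
    refine ⟨εs, hεs, fun ε₀ hε₀ hle α hα νh hν V hV hC hact hbd hsurv => ?_⟩
    obtain ⟨C, hC⟩ := hC
    have hW := isEternalVisc_of_classical (ε₀ := ε₀) (α := α) hν hV hact hbd
    have hU := uniformBound_of_classical (V := V) hC
    refine H ε₀ hε₀ hle α hα νh _ hW hU (survivingFwd_of_crit (a := a) (ε₀ := ε₀) ?_)
    -- the critical variable of the embedded solution is `V` itself on `t < 0`
    obtain ⟨c, hc, Hs⟩ := hsurv
    refine ⟨c, hc, fun N => ?_⟩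
    obtain ⟨n, hn, t, htN, ht, hle'⟩ := Hs N
    refine ⟨n, hn, t, htN, ht, ?_⟩
    have hnt : 0 < -t := neg_pos.2 ht
    have hid : (-t)⁻¹ • (Real.exp (-(-Real.log (-t))) • V (n : ℤ) (0 - Real.exp (-(-Real.log (-t)))))
        = V n t := by
      rw [neg_neg, Real.exp_log hnt, smul_smul, inv_mul_cancel₀ hnt.ne', one_smul]
      congr 1
      ring
    rw [hid]
    exact hle'
  · rintro ⟨εs, hεs, H⟩
    refine ⟨εs, hεs, fun ε₀ hε₀ hle α hα νh W hW hU hS => ?_⟩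
    refine H ε₀ hε₀ hle α hα νh hW.nonneg (fun n t => (-t)⁻¹ • W n (-Real.log (-t)))
      (fun n t ht => hasDerivAt_crit_visc ht (hW.law n _)) (crit_typeI hU) (crit_action hW)
      (fun n => exists_norm_crit_le hW n) ?_
    -- survival of `W` is (surv) for its critical variable
    obtain ⟨c, hc, Hs⟩ := hS
    refine ⟨c, hc, fun N => ?_⟩
    obtain ⟨n, hn, σ, hσ, hle'⟩ := Hs N
    refine ⟨n, hn, -Real.exp (-σ), ?_, neg_neg_iff_pos.2 (Real.exp_pos _), ?_⟩
    · have : Real.exp (-σ) ≤ Real.exp (-(N : ℝ)) := Real.exp_le_exp.2 (by linarith)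
      linarith
    · have hw : ‖(- -Real.exp (-σ))⁻¹ • W (n : ℤ) (-Real.log (- -Real.exp (-σ)))‖ ^ 2
          = Real.exp (2 * σ) * ‖W (n : ℤ) σ‖ ^ 2 := by
        rw [neg_neg, Real.log_exp, neg_neg, ← Real.exp_neg, neg_neg, norm_smul, Real.norm_eq_abs,
          abs_of_pos (Real.exp_pos _), mul_pow, ← Real.exp_nat_mul]
        push_cast
        ring_nf
      rw [hw]
      exact hle'

/-- **THE CRUX K1ᵛ(1) IN CLASSICAL FORM (by name, exact).**
[cite: Tao2016AveragedNS, §4 Thm. 4.2 (statement shape) and the viscous equation before it, §6.4; this file] -/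
theorem noSurvivingEternalViscBddOne_iff_classical :
    NoSurvivingEternalViscBddOne ↔
    ∀ R : ℝ, 1 ≤ R → ∃ εs : ℝ, 0 < εs ∧ ∀ ε₀ : ℝ, 0 < ε₀ → ε₀ ≤ εs →
      ∀ α : Fin 4 → Fin 4 → Fin 4 → ℤ × ℤ × ℤ → ℝ, InTableClass R α →
        ∀ νh : ℝ, 0 ≤ νh → ∀ V : ℤ → ℝ → Em 4,
          (∀ (n : ℤ) (t : ℝ), t < 0 → HasDerivAt (V n)
            (tableQ α (V n t) + bigLam ε₀ • tableA α (V (n - 1) t)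
              + (bigLam ε₀)⁻¹ • tableB α (V (n + 1) t) (V n t)
              - (νh * (1 + ε₀) ^ ((2 : ℝ) * n)) • V n t) t) →
          (∃ C : ℝ, ∀ (n : ℤ) (t : ℝ), t < 0 → ‖V n t‖ ≤ C / (-t)) →
          (∃ M : ℝ, ∀ n : ℤ, IntegrableOn (fun t => ‖V n t‖) (Iio 0) ∧ ∫ t in Iio 0, ‖V n t‖ ≤ M) →
          (∀ n : ℤ, ∃ t₀ : ℝ, t₀ < 0 ∧ ∃ P : ℝ, ∀ t : ℝ, t₀ ≤ t → t < 0 → ‖V n t‖ ≤ P) →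
            ¬ ∃ c : ℝ, 0 < c ∧ ∀ N : ℕ, ∃ n : ℕ, N ≤ n ∧ ∃ t : ℝ, -Real.exp (-(N : ℝ)) ≤ t ∧ t < 0 ∧
                c ≤ physWeight 1 ε₀ ^ n * ‖V n t‖ ^ 2 :=
  ⟨fun h R hR => (noSurvivingEternalViscBdd_iff_classical R 1).1 (h R hR),
    fun h R hR => (noSurvivingEternalViscBdd_iff_classical R 1).2 (h R hR)⟩

/-- **A by-name SUFFICIENT CONDITION for the crux in classical terms** (the `←` direction, for citation).
[cite: Tao2016AveragedNS, §4 Thm. 4.2 (statement shape), §6.4; this file] -/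
theorem noSurvivingEternalViscBddOne_of_classical
    (h : ∀ R : ℝ, 1 ≤ R → ∃ εs : ℝ, 0 < εs ∧ ∀ ε₀ : ℝ, 0 < ε₀ → ε₀ ≤ εs →
      ∀ α : Fin 4 → Fin 4 → Fin 4 → ℤ × ℤ × ℤ → ℝ, InTableClass R α →
        ∀ νh : ℝ, 0 ≤ νh → ∀ V : ℤ → ℝ → Em 4,
          (∀ (n : ℤ) (t : ℝ), t < 0 → HasDerivAt (V n)
            (tableQ α (V n t) + bigLam ε₀ • tableA α (V (n - 1) t)
              + (bigLam ε₀)⁻¹ • tableB α (V (n + 1) t) (V n t)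
              - (νh * (1 + ε₀) ^ ((2 : ℝ) * n)) • V n t) t) →
          (∃ C : ℝ, ∀ (n : ℤ) (t : ℝ), t < 0 → ‖V n t‖ ≤ C / (-t)) →
          (∃ M : ℝ, ∀ n : ℤ, IntegrableOn (fun t => ‖V n t‖) (Iio 0) ∧ ∫ t in Iio 0, ‖V n t‖ ≤ M) →
          (∀ n : ℤ, ∃ t₀ : ℝ, t₀ < 0 ∧ ∃ P : ℝ, ∀ t : ℝ, t₀ ≤ t → t < 0 → ‖V n t‖ ≤ P) →
            ¬ ∃ c : ℝ, 0 < c ∧ ∀ N : ℕ, ∃ n : ℕ, N ≤ n ∧ ∃ t : ℝ, -Real.exp (-(N : ℝ)) ≤ t ∧ t < 0 ∧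
                c ≤ physWeight 1 ε₀ ^ n * ‖V n t‖ ^ 2) :
    NoSurvivingEternalViscBddOne :=
  noSurvivingEternalViscBddOne_iff_classical.2 h

end Summit.NavierStokesRegularity.NavierStokesRegularity.Theorems.NoSurvivingEternalViscBddOne.ClassicalForm

end
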